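import Literature.AlgebraicGeometry.Motives.ProjectiveOfGeneratingSections
import HarnessLib

/-!
# The ratios of `GeneratingSections.ofHom r` as pulled-back sections `r^*(x_j/x_i)`

Topic `Literature/AlgebraicGeometry/Motives`; theorem-only. For a morphism `r : Y → ℙ(ι)` the
ratio `homRatio r i j ∈ Γ(Y, r⁻¹D₊(xᵢ))` of the generating sections `GeneratingSections.ofHom r`
(defined through the chart lift `r⁻¹D₊(xᵢ) → Spec (k[x]_{(xᵢ)})₀`) is the pull-back
`r^*(x_j/xᵢ)` of Mathlib's section `Proj.awayToSection (x_j/xᵢ) ∈ Γ(ℙ(ι), D₊(xᵢ))`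
(`homRatio_eq_appLE`); hence the ratios are natural in `r` (`homRatio_comp_eq_appLE`; cf. `GeneratingSections.homRatio_comp` of `HodgeTheory/HyperplaneClassPullback`, not imported here).

## References

* R. Hartshorne, *Algebraic Geometry* (1977), II Prop. 2.5 (b) and Thm. 7.1 (a). [Hartshorne1977]
-/

noncomputable section

universe u

open CategoryTheory AlgebraicGeometry HomogeneousLocalization TopologicalSpace Opposite
open MvPolynomial (X)
open Literature.AlgebraicGeometry.Motives.Segre

namespace Literature.AlgebraicGeometry.Motives

namespace GeneratingSections

attribute [local instance] MvPolynomial.gradedAlgebra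

variable {ι : Type} {k : Type u} [CommRing k] {Y : Scheme.{u}} (r : Y ⟶ Proj (grading ι k))

/-- **The chart lift is the restriction of `r` followed by `D₊(xᵢ) ≅ Spec (k[x]_{(xᵢ)})₀`.**
[cite: Hartshorne1977, II Prop. 2.5 (b)] -/
theorem chartLift_eq_morphismRestrict (i : ι) :
    chartLift r i = (r ∣_ Proj.basicOpen (grading ι k) (X i)) ≫
      Proj.basicOpenToSpec (grading ι k) (X i) := by
  rw [← cancel_mono (chartι k i), chartLift_chartι, Category.assoc]
  change _ = _ ≫ Proj.basicOpenToSpec (grading ι k) (X i) ≫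
    Proj.awayι (grading ι k) (X i) (X_mem k i) zero_lt_one
  rw [← Proj.basicOpenIsoSpec_inv_ι, ← Proj.basicOpenIsoSpec_hom _ _ (X_mem k i) zero_lt_one,
    Iso.hom_inv_id_assoc, morphismRestrict_ι]

/-- **`homRatio` is the pulled-back section**: transporting `pull (chartLift r i) c` to
`Γ(Y, r⁻¹D₊(xᵢ))` gives `r^*` of the section `awayToSection c ∈ Γ(ℙ(ι), D₊(xᵢ))`.
[cite: Hartshorne1977, II Prop. 2.5 (b)] -/
theorem topIso_hom_pull_chartLift (i : ι) (c : Away (grading ι k) (X i)) :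
    (preU r i).topIso.hom (pull (chartLift r i) c) =
      r.appLE (Proj.basicOpen (grading ι k) (X i)) (preU r i) le_rfl
        (Proj.awayToSection (grading ι k) (X i) c) := by
  rw [pull_apply, chartLift_eq_morphismRestrict, Scheme.Hom.comp_appTop, CommRingCat.comp_apply]
  have h1 : (Proj.basicOpenToSpec (grading ι k) (X i)).appTop
      ((Scheme.ΓSpecIso (CommRingCat.of (Away (grading ι k) (X i)))).inv c) =
      (Proj.basicOpen (grading ι k) (X i)).topIso.inv (Proj.awayToSection (grading ι k) (X i) c) := by
    rw [Scheme.Hom.appTop, Proj.basicOpenToSpec_app_top, CommRingCat.comp_apply,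
      CommRingCat.comp_apply, ← CommRingCat.comp_apply _ (Scheme.ΓSpecIso _).hom, Iso.inv_hom_id,
      CommRingCat.id_apply]
  rw [h1]
  have key : (Proj.basicOpen (grading ι k) (X i)).topIso.inv ≫
      (r ∣_ Proj.basicOpen (grading ι k) (X i)).appTop ≫ (preU r i).topIso.hom =
      r.appLE (Proj.basicOpen (grading ι k) (X i)) (preU r i) le_rfl := by
    rw [morphismRestrict_appTop]
    simp only [Scheme.Opens.topIso_inv, Scheme.Opens.topIso_hom, Scheme.Hom.app_eq_appLE,
      Scheme.Hom.appLE_map]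
    erw [Scheme.Hom.appLE_map, Scheme.Hom.map_appLE]
  change ((Proj.basicOpen (grading ι k) (X i)).topIso.inv ≫
      (r ∣_ Proj.basicOpen (grading ι k) (X i)).appTop ≫ (preU r i).topIso.hom)
    (Proj.awayToSection (grading ι k) (X i) c) = _
  rw [key]

/-- **`homRatio r i j = r^*(x_j/xᵢ)`.** [cite: Hartshorne1977, II Thm. 7.1 (a)] -/
theorem homRatio_eq_appLE (i j : ι) :
    homRatio r i j = r.appLE (Proj.basicOpen (grading ι k) (X i)) (preU r i) le_rfl
      (Proj.awayToSection (grading ι k) (X i) (frac k i j)) :=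
  topIso_hom_pull_chartLift r i _

/-- **Naturality of the ratios**: for `g : Y' → Y`, `homRatio (g ≫ r) i j = g^*(homRatio r i j)`.
[cite: Hartshorne1977, II Thm. 7.1 (a)] -/
theorem homRatio_comp_eq_appLE {Y' : Scheme.{u}} (g : Y' ⟶ Y) (i j : ι) :
    homRatio (g ≫ r) i j = g.appLE (preU r i) (preU (g ≫ r) i) le_rfl (homRatio r i j) := by
  rw [homRatio_eq_appLE, homRatio_eq_appLE]
  change _ = (r.appLE (Proj.basicOpen (grading ι k) (X i)) (preU r i) le_rfl ≫
    g.appLE (preU r i) (preU (g ≫ r) i) le_rfl) (Proj.awayToSection (grading ι k) (X i) (frac k i j))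
  rw [Scheme.Hom.appLE_comp_appLE]

end GeneratingSections

end Literature.AlgebraicGeometry.Motives

end
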